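import Summits.QuantumFields.BalabanUV.T4Continuum.Support.VariationalColourBochner
import Summits.QuantumFields.BalabanUV.T4Continuum.Support.VariationalVectorForm

/-!
# T⁴ programme, spine node NE2 (U1a), lane P2 — LEAF V-P, THE GÅRDING HALF, file 1: THE LATTICE WEITZENBÖCK IDENTITY for `E`-valued 1-forms
# in the road's function world (`VariationalVectorForm`'s covariant curl, the covariant divergence, the rough form) and the two-sided bound
# `|rough − (½·curl² + div²)| ≤ d·p·Σ‖W‖²` by the plaquette defect `p` of UNITARY bond transports (model level; ONE level, every torus)

NE2 formalisation swarm `b2b-balaban-t4-ne2-formalise-*`, leaf prover 09 GEN 6 (`prover-b2b-balaban-t4-ne2-formalise-leaf-09-g6-0`); journal INTENT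
CLAIMS.log 2026-08-20 12:42Z «V-P PROPER = THE GÅRDING HALF».  Skeleton `t4/skeletons/NE2-t4-ne2-p2.md` v0.15 §2.E row V-P «coercivity on 1-forms …
Weitzenböck (½curlᴴcurl + divᴴdiv = rough Laplacian + commutators) reduces to d copies of the 0-form P⁺ + commutator defects»: leaf-01-g5's V-P CORE (i)
(`VariationalVectorPoincare`) is the «d copies of the 0-form P⁺» half and names the remaining GÅRDING inequality
`n^{−d}(n²·roughV R W) ≤ κ·ScV n M R G W + κ′·nsqV M (Q W)`; this file is the Weitzenböck half of it, file 2 (`VariationalVectorGarding`) the Gårding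
read-out.  On top of this lineage's colour Bochner carriers `VariationalColourBochner.{Dirv, DirAdjv, ipv, ipv_DirAdjv, Dirv_DirAdjv_comm,
norm_kappa1v_le, nsqv_DirAdjv_eq}` (p215065) and of the road owner's `VariationalVectorForm.{cdV, curlV, curlSq}` (p216339) — BY NAME; the covariant
difference of the road IS the colour carrier read per component: `cdV R W x μ ν = Dirv μ (W·ν) x` (`cdV_eq_Dirv`, `rfl`).

THE STATEMENT (model level; lattice units).  `E` a complex Hilbert space; 1-forms `W : Tor N → Fin d → E`; bond transports `R : Tor N → Fin d → (E →L[ℂ] E)`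
(DATA).  With `D_μW_ν(x) = R(x,μ)W(x+e_μ,ν) − W(x,ν)`, the formal adjoint `D_μ†`, the covariant DIVERGENCE `div_R W (x) := Σ_μ (D_μ† W_μ)(x)` (`divV`),
`divSq R W := Σ_x ‖div_R W (x)‖²`, the rough form `Σ_{x,μ,ν}‖D_μW_ν(x)‖²` and the road's `curlSq R W = Σ_{x,μ,ν}‖D_μW_ν(x) − D_νW_μ(x)‖²`:
 * §2 **`weitzenbock`** (EXACT, ANY transports): `Σ‖D_μW_ν‖² = curlSq∕2 + divSq − Re Σ_{μ,ν} ⟨W_ν, [D_ν, D_μ†] W_μ⟩_{ℓ²}`, the commutator being the OPERATOR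
   coefficient `κ₁(x) = R(x,ν)R(x−e_μ+e_ν,μ)⋆ − R(x−e_μ,μ)⋆R(x−e_μ,ν)` at the translated argument (`Dirv_DirAdjv_comm`) — the function-world twin of P1's
   matrix identity `LatticeWeitzenbock.weitzenbock` (½curlᴴcurl + divᴴdiv = rough + commutators; not imported, different carrier);
 * §3 for UNITARY transports with plaquette defect `‖R(x,μ)∘R(x+e_μ,ν) − R(x,ν)∘R(x+e_ν,μ)‖ ≤ p` in operator norm (the binders of `hessian_le`, verbatim):
   **`norm_commutatorSum_le`** `‖Σ_{μ,ν} ⟨W_ν, [D_ν, D_μ†] W_μ⟩‖ ≤ d·p·nsqV W`, hence **`abs_rough_sub_le`** `|Σ‖D_μW_ν‖² − (curlSq∕2 + divSq)| ≤ d·p·nsqV W` and, on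
   the level-`n` torus, **`abs_roughV_sub_le`** ∕ `roughV_le_curl_div` ∕ `curl_div_le_roughV` for leaf-03-g4's `roughV n M R W` (`VariationalVectorForm.roughV_eq`);
 * §4 **`divSq_le_mul_rough`** (unitary `R`): `divSq R W ≤ d·Σ_{x,μ}‖D_μW_μ(x)‖² ≤ d·Σ‖D_μW_ν‖²` (`‖D_μ†g‖² = ‖D_μg‖²`), `divSq_le_mul_roughV`; `continuous_divSq`.
So for a flat background (`p = 0`) `rough = ½curl² + div²` exactly, and in general the curvature enters ONLY through `d·p·Σ‖W‖²` — absorbed in file 2 by any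
rough Poincaré inequality under the plaquette class `n²·p ≤ c` of the scalar END.

HONEST FRAMING (T4-DAG p. 1).  Model level; transports DATA (no identification with Bałaban's `U(Γ)` — c5); [folklore] lattice calculus (exact adjointness and
commutator identities + Cauchy–Schwarz∕AM–GM); nothing printed is a hypothesis; data `def`s `divV`, `divSq` only, no `def … : Prop`, no `sorry`; axioms standard.
Leaf V-P NOT proved here (file 2 reads it out of a displayed divergence control of the gauge functional); NE2 NOT proved; spine PROVED 0∕9 unchanged; rung (B)+1
finite T⁴ — NOT infinite volume, NOT mass gap, NOT Clay.  HONEST DEPENDENCY (cell, verbatim): continuum YM on T⁴ ⇐ BetaPertH ∧ nine spine estimates (0/9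
proved); BetaPertH ⇐ (D1) ∧ (D4) ∧ CAP+tail; G-an2-4 gates asym, D1 and NE2/3/4.
-/

noncomputable section

namespace Summit.QuantumFields.BalabanUV.T4Continuum.VariationalVectorWeitzenbock

open Finset
open scoped InnerProductSpace ComplexConjugate
open Literature.MathematicalPhysics.QuantumFieldTheory.Balaban1983to89.B5Prop11Plancherel (Tor fine unitVec)
open Summit.QuantumFields.BalabanUV.T4Continuum.VariationalColourFederbush (cDv)
open Summit.QuantumFields.BalabanUV.T4Continuum.VariationalColourBochner
  (nsqv nsqv_nonneg Dirv DirAdjv ipv ipv_self conj_ipv norm_ipv_le ipv_DirAdjv Dirv_DirAdjv_comm norm_kappa1v_le sum_sq_translate nsqv_DirAdjv_eq)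
open Summit.QuantumFields.BalabanUV.T4Continuum.VariationalCovariantBochner (mul_mul_le_half)
open Summit.QuantumFields.BalabanUV.T4Continuum.VectorBlockTrialForm (nsqV nsqV_nonneg roughV roughV_nonneg)
open Summit.QuantumFields.BalabanUV.T4Continuum.VariationalVectorForm (cdV curlV curlSq curlSq_nonneg roughV_eq)

variable {d : ℕ} (N : Fin d → ℕ) [∀ μ, NeZero (N μ)]
variable {E : Type*} [NormedAddCommGroup E] [InnerProductSpace ℂ E] [CompleteSpace E]

/-! ## §1 The covariant divergence of an `E`-valued 1-form and its square sum -/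

/-- **the covariant DIVERGENCE** `div_R W (x) = Σ_μ (D_μ† W_μ)(x) = Σ_μ (R(x−e_μ,μ)⋆ W(x−e_μ,μ) − W(x,μ))` — the formal adjoint of the covariant gradient
applied componentwise (`VariationalColourBochner.DirAdjv`, BY NAME; at `R = 1` the lattice divergence `∂*` of [B5] (1.21) up to the sign convention;
transports DATA). [folklore] -/
def divV (R : Tor N → Fin d → (E →L[ℂ] E)) (W : Tor N → Fin d → E) (x : Tor N) : E :=
  ∑ μ, DirAdjv N R μ (fun y => W y μ) x

omit [∀ μ, NeZero (N μ)] in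
/-- the entries of the covariant divergence. [folklore] -/
theorem divV_apply (R : Tor N → Fin d → (E →L[ℂ] E)) (W : Tor N → Fin d → E) (x : Tor N) :
    divV N R W x = ∑ μ, (star (R (x - unitVec N μ) μ) (W (x - unitVec N μ) μ) - W x μ) := rfl

/-- **the divergence form** `divSq R W = Σ_x ‖div_R W (x)‖²` (lattice units). [folklore] -/
def divSq (R : Tor N → Fin d → (E →L[ℂ] E)) (W : Tor N → Fin d → E) : ℝ := ∑ x, ‖divV N R W x‖ ^ 2

/-- `0 ≤ divSq`. [folklore] -/
theorem divSq_nonneg (R : Tor N → Fin d → (E →L[ℂ] E)) (W : Tor N → Fin d → E) : 0 ≤ divSq N R W :=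
  sum_nonneg fun _ _ => by positivity

/-- `divSq` is the `ℓ²` size of the divergence field. [folklore] -/
theorem divSq_eq_nsqv (R : Tor N → Fin d → (E →L[ℂ] E)) (W : Tor N → Fin d → E) : divSq N R W = nsqv N (divV N R W) := rfl

/-- `divSq` is continuous in the 1-form. [folklore] -/
theorem continuous_divSq (R : Tor N → Fin d → (E →L[ℂ] E)) : Continuous fun W : Tor N → Fin d → E => divSq N R W := by
  unfold divSq divV DirAdjv
  refine continuous_finsetSum _ fun x _ => ((continuous_finsetSum _ fun μ _ => ?_).norm).pow 2
  exact ((star (R (x - unitVec N μ) μ)).continuous.comp ((continuous_apply μ).comp (continuous_apply _))).sub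
    ((continuous_apply μ).comp (continuous_apply x))

omit [∀ μ, NeZero (N μ)] [CompleteSpace E] in
/-- **the road's covariant difference IS the colour carrier read per component**: `D_μW_ν(x) = (Dirv μ (W·ν))(x)`. [folklore] -/
theorem cdV_eq_Dirv (R : Tor N → Fin d → (E →L[ℂ] E)) (W : Tor N → Fin d → E) (x : Tor N) (μ ν : Fin d) :
    cdV N R W x μ ν = Dirv N R μ (fun y => W y ν) x := rfl

omit [InnerProductSpace ℂ E] [CompleteSpace E] in
/-- `nsqV W = Σ_μ nsqv (W·μ)`. [folklore] -/
theorem nsqV_eq_sum_nsqv (W : Tor N → Fin d → E) : nsqV N W = ∑ μ, ∑ x, ‖W x μ‖ ^ 2 := by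
  unfold nsqV; exact Finset.sum_comm

omit [CompleteSpace E] in
/-- the rough form as the sum over ordered pairs of the `ℓ²` sizes of the colour carriers: `Σ_{x,μ,ν}‖D_μW_ν(x)‖² = Σ_{μ,ν} nsqv (Dirv μ (W·ν))`. [folklore] -/
theorem rough_eq_sum_nsqv (R : Tor N → Fin d → (E →L[ℂ] E)) (W : Tor N → Fin d → E) :
    ∑ x, ∑ μ, ∑ ν, ‖cdV N R W x μ ν‖ ^ 2 = ∑ μ, ∑ ν, nsqv N (Dirv N R μ (fun y => W y ν)) := by
  rw [Finset.sum_comm]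
  refine sum_congr rfl fun μ _ => ?_
  rw [Finset.sum_comm]
  rfl

/-! ## §2 The exact Weitzenböck identity -/

omit [CompleteSpace E] in
/-- the pairing is subtractive in the second slot. [folklore] -/
theorem ipv_sub_right (g f h : Tor N → E) : ipv N g (fun x => f x - h x) = ipv N g f - ipv N g h := by
  unfold ipv; rw [← sum_sub_distrib]
  exact sum_congr rfl fun x _ => inner_sub_right _ _ _

omit [CompleteSpace E] in
/-- **THE CURL FORM EXPANDED**: `curlSq = 2·Σ‖D_μW_ν‖² − 2·Re Σ_{μ,ν} ⟨D_μW_ν, D_νW_μ⟩_{ℓ²}` (`‖a − b‖² = ‖a‖² + ‖b‖² − 2Re⟨a,b⟩`, and the `‖b‖²` half is the rough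
form again after swapping `μ ↔ ν`). [folklore] -/
theorem curlSq_eq (R : Tor N → Fin d → (E →L[ℂ] E)) (W : Tor N → Fin d → E) :
    curlSq N R W = 2 * ∑ x, ∑ μ, ∑ ν, ‖cdV N R W x μ ν‖ ^ 2
      - 2 * (∑ μ, ∑ ν, ipv N (Dirv N R μ (fun y => W y ν)) (Dirv N R ν (fun y => W y μ))).re := by
  have hpt : ∀ (x : Tor N) (μ ν : Fin d), ‖cdV N R W x μ ν - cdV N R W x ν μ‖ ^ 2
      = ‖cdV N R W x μ ν‖ ^ 2 + ‖cdV N R W x ν μ‖ ^ 2 - 2 * (⟪cdV N R W x μ ν, cdV N R W x ν μ⟫_ℂ).re := by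
    intro x μ ν
    rw [@norm_sub_sq ℂ, RCLike.re_to_complex]
    ring
  have hswap : ∑ x, ∑ μ, ∑ ν, ‖cdV N R W x ν μ‖ ^ 2 = ∑ x, ∑ μ, ∑ ν, ‖cdV N R W x μ ν‖ ^ 2 :=
    sum_congr rfl fun x _ => Finset.sum_comm
  have hre : (∑ μ, ∑ ν, ipv N (Dirv N R μ (fun y => W y ν)) (Dirv N R ν (fun y => W y μ))).re
      = ∑ x, ∑ μ, ∑ ν, (⟪cdV N R W x μ ν, cdV N R W x ν μ⟫_ℂ).re := by
    rw [Complex.re_sum, Finset.sum_comm]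
    refine sum_congr rfl fun μ _ => ?_
    rw [Complex.re_sum, Finset.sum_comm]
    refine sum_congr rfl fun ν _ => ?_
    unfold ipv; rw [Complex.re_sum]; rfl
  unfold curlSq curlV
  simp_rw [hpt, sum_sub_distrib, sum_add_distrib, ← mul_sum]
  rw [hswap, hre]; ring

/-- **THE CROSS TERM THROUGH THE ADJOINT**: `⟨D_μW_ν, D_νW_μ⟩_{ℓ²} = ⟨W_ν, D_μ†D_νW_μ⟩_{ℓ²}`. [folklore] -/
theorem cross_eq (R : Tor N → Fin d → (E →L[ℂ] E)) (W : Tor N → Fin d → E) (μ ν : Fin d) :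
    ipv N (Dirv N R μ (fun y => W y ν)) (Dirv N R ν (fun y => W y μ))
      = ipv N (fun y => W y ν) (DirAdjv N R μ (Dirv N R ν (fun y => W y μ))) :=
  (ipv_DirAdjv N R μ _ _).symm

/-- **THE DIVERGENCE FORM THROUGH THE ADJOINT**: `divSq = Σ_{μ,ν} ⟨W_ν, D_νD_μ†W_μ⟩_{ℓ²}` (as a complex number). [folklore] -/
theorem divSq_eq_sum_ipv (R : Tor N → Fin d → (E →L[ℂ] E)) (W : Tor N → Fin d → E) :
    ((divSq N R W : ℝ) : ℂ) = ∑ μ, ∑ ν, ipv N (fun y => W y ν) (Dirv N R ν (DirAdjv N R μ (fun y => W y μ))) := by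
  -- `‖div W (x)‖² = Σ_{ν,μ} ⟨D_ν†W_ν (x), D_μ†W_μ (x)⟩`
  have h1 : ((divSq N R W : ℝ) : ℂ) = ∑ μ, ∑ ν, ipv N (DirAdjv N R ν (fun y => W y ν)) (DirAdjv N R μ (fun y => W y μ)) := by
    rw [divSq_eq_nsqv, ← ipv_self]
    have hx : ∀ x, ⟪divV N R W x, divV N R W x⟫_ℂ = ∑ μ, ∑ ν, ⟪DirAdjv N R ν (fun y => W y ν) x, DirAdjv N R μ (fun y => W y μ) x⟫_ℂ := by
      intro x
      unfold divV
      rw [inner_sum]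
      exact sum_congr rfl fun μ _ => sum_inner _ _ _
    unfold ipv
    simp_rw [hx]
    rw [Finset.sum_comm]
    refine sum_congr rfl fun μ _ => ?_
    rw [Finset.sum_comm]
  rw [h1]
  refine sum_congr rfl fun μ _ => sum_congr rfl fun ν _ => ?_
  -- `⟨D_ν†W_ν, D_μ†W_μ⟩ = conj ⟨D_μ†W_μ, D_ν†W_ν⟩ = conj ⟨D_ν D_μ†W_μ, W_ν⟩ = ⟨W_ν, D_ν D_μ†W_μ⟩`
  rw [← conj_ipv, ipv_DirAdjv, conj_ipv]

/-- **THE LATTICE WEITZENBÖCK IDENTITY (exact, any transports)**: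
`Σ_{x,μ,ν}‖D_μW_ν(x)‖² = curlSq∕2 + divSq − Re Σ_{μ,ν} ⟨W_ν, [D_ν, D_μ†] W_μ⟩_{ℓ²}`, `[D_ν, D_μ†]g = D_ν(D_μ†g) − D_μ†(D_νg)` — the function-world twin of
`LatticeWeitzenbock.weitzenbock` (½curlᴴcurl + divᴴdiv = rough + commutators). [folklore] -/
theorem weitzenbock (R : Tor N → Fin d → (E →L[ℂ] E)) (W : Tor N → Fin d → E) :
    ∑ x, ∑ μ, ∑ ν, ‖cdV N R W x μ ν‖ ^ 2
      = curlSq N R W / 2 + divSq N R W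
        - (∑ μ, ∑ ν, ipv N (fun y => W y ν)
            (fun x => Dirv N R ν (DirAdjv N R μ (fun y => W y μ)) x - DirAdjv N R μ (Dirv N R ν (fun y => W y μ)) x)).re := by
  set X : ℂ := ∑ μ, ∑ ν, ipv N (Dirv N R μ (fun y => W y ν)) (Dirv N R ν (fun y => W y μ)) with hX
  set D : ℂ := ∑ μ, ∑ ν, ipv N (fun y => W y ν) (Dirv N R ν (DirAdjv N R μ (fun y => W y μ))) with hD
  have hcurl := curlSq_eq N R W
  rw [← hX] at hcurl
  have hDre : D.re = divSq N R W := by rw [hD, ← divSq_eq_sum_ipv, Complex.ofReal_re]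
  have hcomm : ∑ μ, ∑ ν, ipv N (fun y => W y ν)
      (fun x => Dirv N R ν (DirAdjv N R μ (fun y => W y μ)) x - DirAdjv N R μ (Dirv N R ν (fun y => W y μ)) x) = D - X := by
    rw [hD, hX, ← sum_sub_distrib]
    refine sum_congr rfl fun μ _ => ?_
    rw [← sum_sub_distrib]
    refine sum_congr rfl fun ν _ => ?_
    rw [ipv_sub_right, cross_eq]
  rw [hcomm, Complex.sub_re, hDre]
  linarith

omit [∀ μ, NeZero (N μ)] in
/-- the commutator field is the operator coefficient `κ₁` at the translated argument (`Dirv_DirAdjv_comm`, as a field identity). [folklore] -/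
theorem commutator_field_eq (R : Tor N → Fin d → (E →L[ℂ] E)) (W : Tor N → Fin d → E) (μ ν : Fin d) :
    (fun x => Dirv N R ν (DirAdjv N R μ (fun y => W y μ)) x - DirAdjv N R μ (Dirv N R ν (fun y => W y μ)) x)
      = fun x => (R x ν * star (R (x - unitVec N μ + unitVec N ν) μ) - star (R (x - unitVec N μ) μ) * R (x - unitVec N μ) ν)
          (W (x - unitVec N μ + unitVec N ν) μ) :=
  funext fun x => Dirv_DirAdjv_comm N R μ ν _ x

/-! ## §3 Unitary transports: the commutators are plaquette defects, `|rough − (½curl² + div²)| ≤ d·p·Σ‖W‖²` -/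

/-- **THE COMMUTATOR SUM IS A CURVATURE TERM**: for UNITARY transports with plaquette defect `≤ p` in operator norm,
`‖Σ_{μ,ν} ⟨W_ν, [D_ν, D_μ†] W_μ⟩_{ℓ²}‖ ≤ d·p·nsqV W` (`‖κ₁‖ ≤ p` by `norm_kappa1v_le`, then `uv ≤ (u² + v²)∕2` and translation invariance). [folklore] -/
theorem norm_commutatorSum_le {R : Tor N → Fin d → (E →L[ℂ] E)} (hU : ∀ x μ, R x μ ∈ unitary (E →L[ℂ] E)) {p : ℝ} (hp : 0 ≤ p)
    (hP : ∀ x μ ν, ‖R x μ * R (x + unitVec N μ) ν - R x ν * R (x + unitVec N ν) μ‖ ≤ p) (W : Tor N → Fin d → E) :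
    ‖∑ μ, ∑ ν, ipv N (fun y => W y ν)
        (fun x => Dirv N R ν (DirAdjv N R μ (fun y => W y μ)) x - DirAdjv N R μ (Dirv N R ν (fun y => W y μ)) x)‖
      ≤ d * p * nsqV N W := by
  -- one ordered pair `(μ, ν)`
  have hterm : ∀ μ ν : Fin d, ‖ipv N (fun y => W y ν)
      (fun x => Dirv N R ν (DirAdjv N R μ (fun y => W y μ)) x - DirAdjv N R μ (Dirv N R ν (fun y => W y μ)) x)‖
        ≤ p / 2 * (∑ x, ‖W x ν‖ ^ 2 + ∑ x, ‖W x μ‖ ^ 2) := by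
    intro μ ν
    rw [commutator_field_eq]
    refine (norm_ipv_le N _ _).trans ?_
    have hpt : ∀ x, ‖W x ν‖ * ‖(R x ν * star (R (x - unitVec N μ + unitVec N ν) μ) - star (R (x - unitVec N μ) μ) * R (x - unitVec N μ) ν)
        (W (x - unitVec N μ + unitVec N ν) μ)‖ ≤ (p * ‖W x ν‖ ^ 2 + p * ‖W (x - unitVec N μ + unitVec N ν) μ‖ ^ 2) / 2 := by
      intro x
      have hk := norm_kappa1v_le N hU hP μ ν x
      calc _ ≤ ‖W x ν‖ * (p * ‖W (x - unitVec N μ + unitVec N ν) μ‖) :=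
            mul_le_mul_of_nonneg_left ((ContinuousLinearMap.le_opNorm _ _).trans (mul_le_mul_of_nonneg_right hk (norm_nonneg _))) (norm_nonneg _)
        _ ≤ _ := (mul_mul_le_half _ _ hp).1
    refine (sum_le_sum fun x _ => hpt x).trans (le_of_eq ?_)
    have htr : ∑ x, ‖W (x - unitVec N μ + unitVec N ν) μ‖ ^ 2 = ∑ x, ‖W x μ‖ ^ 2 := by
      have := sum_sq_translate N (fun y => W y μ) (-unitVec N μ + unitVec N ν)
      rw [← this]
      exact sum_congr rfl fun x _ => by rw [← add_assoc, ← sub_eq_add_neg]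
    rw [← sum_div, sum_add_distrib, ← mul_sum, ← mul_sum, htr]
    ring
  -- sum over ordered pairs
  have hsym : ∑ μ : Fin d, ∑ ν : Fin d, (∑ x, ‖W x ν‖ ^ 2 + ∑ x, ‖W x μ‖ ^ 2) = 2 * (d * nsqV N W) := by
    rw [nsqV_eq_sum_nsqv]
    simp only [sum_add_distrib, sum_const, card_univ, Fintype.card_fin, nsmul_eq_mul]
    rw [← mul_sum]
    ring
  calc _ ≤ ∑ μ, ‖∑ ν, ipv N (fun y => W y ν)
          (fun x => Dirv N R ν (DirAdjv N R μ (fun y => W y μ)) x - DirAdjv N R μ (Dirv N R ν (fun y => W y μ)) x)‖ := norm_sum_le _ _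
    _ ≤ ∑ μ, ∑ ν, p / 2 * (∑ x, ‖W x ν‖ ^ 2 + ∑ x, ‖W x μ‖ ^ 2) :=
        sum_le_sum fun μ _ => (norm_sum_le _ _).trans (sum_le_sum fun ν _ => hterm μ ν)
    _ = p / 2 * ∑ μ, ∑ ν, (∑ x, ‖W x ν‖ ^ 2 + ∑ x, ‖W x μ‖ ^ 2) := by simp only [mul_sum]
    _ = d * p * nsqV N W := by rw [hsym]; ring

/-- **`|Σ‖D_μW_ν‖² − (curlSq∕2 + divSq)| ≤ d·p·nsqV W`** — the Weitzenböck identity with the curvature commutators bounded. [folklore] -/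
theorem abs_rough_sub_le {R : Tor N → Fin d → (E →L[ℂ] E)} (hU : ∀ x μ, R x μ ∈ unitary (E →L[ℂ] E)) {p : ℝ} (hp : 0 ≤ p)
    (hP : ∀ x μ ν, ‖R x μ * R (x + unitVec N μ) ν - R x ν * R (x + unitVec N ν) μ‖ ≤ p) (W : Tor N → Fin d → E) :
    |∑ x, ∑ μ, ∑ ν, ‖cdV N R W x μ ν‖ ^ 2 - (curlSq N R W / 2 + divSq N R W)| ≤ d * p * nsqV N W := by
  rw [weitzenbock N R W]
  have h := norm_commutatorSum_le N hU hp hP W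
  set z : ℂ := ∑ μ, ∑ ν, ipv N (fun y => W y ν)
    (fun x => Dirv N R ν (DirAdjv N R μ (fun y => W y μ)) x - DirAdjv N R μ (Dirv N R ν (fun y => W y μ)) x)
  have hre : |z.re| ≤ ‖z‖ := Complex.abs_re_le_norm z
  rw [show curlSq N R W / 2 + divSq N R W - z.re - (curlSq N R W / 2 + divSq N R W) = -z.re by ring, abs_neg]
  exact hre.trans h

section Level
variable (n : ℕ) [NeZero n] (M : Fin d → ℕ) [hM : ∀ μ, NeZero (M μ)]

/-- **ON THE LEVEL-`n` TORUS, FOR leaf-03-g4's ROUGH FORM**: `|roughV n M R W − (curlSq∕2 + divSq)| ≤ d·p·nsqV W`. [folklore] -/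
theorem abs_roughV_sub_le {R : Tor (fine n M) → Fin d → (E →L[ℂ] E)} (hU : ∀ x μ, R x μ ∈ unitary (E →L[ℂ] E)) {p : ℝ} (hp : 0 ≤ p)
    (hP : ∀ x μ ν, ‖R x μ * R (x + unitVec (fine n M) μ) ν - R x ν * R (x + unitVec (fine n M) ν) μ‖ ≤ p)
    (W : Tor (fine n M) → Fin d → E) :
    |roughV n M R W - (curlSq (fine n M) R W / 2 + divSq (fine n M) R W)| ≤ d * p * nsqV (fine n M) W := by
  rw [roughV_eq]; exact abs_rough_sub_le (fine n M) hU hp hP W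

/-- one side: **`roughV ≤ curlSq∕2 + divSq + d·p·nsqV W`**. [folklore] -/
theorem roughV_le_curl_div {R : Tor (fine n M) → Fin d → (E →L[ℂ] E)} (hU : ∀ x μ, R x μ ∈ unitary (E →L[ℂ] E)) {p : ℝ} (hp : 0 ≤ p)
    (hP : ∀ x μ ν, ‖R x μ * R (x + unitVec (fine n M) μ) ν - R x ν * R (x + unitVec (fine n M) ν) μ‖ ≤ p)
    (W : Tor (fine n M) → Fin d → E) :
    roughV n M R W ≤ curlSq (fine n M) R W / 2 + divSq (fine n M) R W + d * p * nsqV (fine n M) W := by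
  have h := abs_roughV_sub_le n M hU hp hP W
  rw [abs_le] at h
  linarith [h.2]

/-- the other side: **`curlSq∕2 + divSq ≤ roughV + d·p·nsqV W`**. [folklore] -/
theorem curl_div_le_roughV {R : Tor (fine n M) → Fin d → (E →L[ℂ] E)} (hU : ∀ x μ, R x μ ∈ unitary (E →L[ℂ] E)) {p : ℝ} (hp : 0 ≤ p)
    (hP : ∀ x μ ν, ‖R x μ * R (x + unitVec (fine n M) μ) ν - R x ν * R (x + unitVec (fine n M) ν) μ‖ ≤ p)
    (W : Tor (fine n M) → Fin d → E) :
    curlSq (fine n M) R W / 2 + divSq (fine n M) R W ≤ roughV n M R W + d * p * nsqV (fine n M) W := by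
  have h := abs_roughV_sub_le n M hU hp hP W
  rw [abs_le] at h
  linarith [h.1]

end Level

/-! ## §4 The divergence form is dominated by the rough form (unitary transports) -/

/-- **`divSq ≤ d·Σ_{μ} nsqv (D_μ (W·μ)) `** for UNITARY transports (Cauchy–Schwarz over the `d` directions, then `‖D_μ†g‖² = ‖D_μg‖²`). [folklore] -/
theorem divSq_le_mul_diag {R : Tor N → Fin d → (E →L[ℂ] E)} (hU : ∀ x μ, R x μ ∈ unitary (E →L[ℂ] E)) (W : Tor N → Fin d → E) :
    divSq N R W ≤ d * ∑ μ, nsqv N (Dirv N R μ (fun y => W y μ)) := by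
  have hpt : ∀ x, ‖divV N R W x‖ ^ 2 ≤ d * ∑ μ, ‖DirAdjv N R μ (fun y => W y μ) x‖ ^ 2 := by
    intro x
    unfold divV
    calc ‖∑ μ, DirAdjv N R μ (fun y => W y μ) x‖ ^ 2 ≤ (∑ μ, ‖DirAdjv N R μ (fun y => W y μ) x‖) ^ 2 :=
          pow_le_pow_left₀ (norm_nonneg _) (norm_sum_le _ _) 2
      _ = (∑ μ, ‖DirAdjv N R μ (fun y => W y μ) x‖ * 1) ^ 2 := by simp only [mul_one]
      _ ≤ (∑ μ, ‖DirAdjv N R μ (fun y => W y μ) x‖ ^ 2) * ∑ _μ : Fin d, (1 : ℝ) ^ 2 := sum_mul_sq_le_sq_mul_sq _ _ _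
      _ = d * ∑ μ, ‖DirAdjv N R μ (fun y => W y μ) x‖ ^ 2 := by
          rw [one_pow, sum_const, card_univ, Fintype.card_fin, nsmul_eq_mul, mul_one, mul_comm]
  unfold divSq
  refine (sum_le_sum fun x _ => hpt x).trans (le_of_eq ?_)
  rw [← mul_sum, Finset.sum_comm]
  congr 1
  refine sum_congr rfl fun μ _ => ?_
  rw [← nsqv_DirAdjv_eq N hU μ]; rfl

/-- **`divSq ≤ d·Σ_{x,μ,ν}‖D_μW_ν(x)‖²`** (the diagonal terms are part of the rough form). [folklore] -/
theorem divSq_le_mul_rough {R : Tor N → Fin d → (E →L[ℂ] E)} (hU : ∀ x μ, R x μ ∈ unitary (E →L[ℂ] E)) (W : Tor N → Fin d → E) :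
    divSq N R W ≤ d * ∑ x, ∑ μ, ∑ ν, ‖cdV N R W x μ ν‖ ^ 2 := by
  refine (divSq_le_mul_diag N hU W).trans ?_
  rw [rough_eq_sum_nsqv]
  refine mul_le_mul_of_nonneg_left (sum_le_sum fun μ _ => ?_) (Nat.cast_nonneg d)
  exact single_le_sum (f := fun ν => nsqv N (Dirv N R μ (fun y => W y ν))) (fun ν _ => nsqv_nonneg N _) (mem_univ μ)

/-- **ON THE LEVEL-`n` TORUS**: `divSq ≤ d·roughV n M R W`. [folklore] -/
theorem divSq_le_mul_roughV (n : ℕ) [NeZero n] (M : Fin d → ℕ) [∀ μ, NeZero (M μ)] {R : Tor (fine n M) → Fin d → (E →L[ℂ] E)}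
    (hU : ∀ x μ, R x μ ∈ unitary (E →L[ℂ] E)) (W : Tor (fine n M) → Fin d → E) :
    divSq (fine n M) R W ≤ d * roughV n M R W := by
  rw [roughV_eq]; exact divSq_le_mul_rough (fine n M) hU W

end Summit.QuantumFields.BalabanUV.T4Continuum.VariationalVectorWeitzenbock

end
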